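import Literature.Analysis.Complex.AffineHypersurfaceFibreClusters
import Literature.Analysis.Complex.PolynomialGrowthLiouvilleSCV
import HarnessLib

/-!
# Fibre sums of a holomorphic function of polynomial growth along a monic projection are polynomials

Layer `Literature/Analysis/Complex`, sequel of `AffineHypersurfaceFibreClusters` (setting: `P = Σ_j a_j(w) X^j`,
`a_j ∈ ℂ[w₁, …, w_m]`, `P.coeff d = c ≠ 0`, `deg a_j ≤ d - j`, fibre polynomials `P_w`, hypersurface
`U = {(w, t) | P_w(t) = 0}`). Let `g` be a function on `U` which is locally the restriction of holomorphic functions of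
`ℂ^m × ℂ` and has polynomial growth `|g(w, t)| ≤ C (1 + |(w, t)|)^k` on `U`. Then (Serre, GAGA n° 19 Lemme 8: "les
fonctions symétriques élémentaires … sont des fonctions holomorphes entières à croissance polynomiale, donc des
polynômes") the **fibre sums** `b_l(w) = Σ_{P_w(ρ) = 0} ρ^l g(w, ρ)` (roots with multiplicity) are:

* `differentiable_fibreSum` — ENTIRE: near `w₀` the sum splits over the clusters of roots around the roots `τ` of
  `P_{w₀}` (`exists_cluster_package`), and on each cluster it is the logarithmic residue
  `(2πi)⁻¹ ∮_{|t-τ|=ε} ρ^l G_τ ∂_t P_w / P_w`, holomorphic in `w` (`WeierstrassData.differentiableOn_rootSum`);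
* `norm_fibreSum_le` — of POLYNOMIAL GROWTH `(1 + |w|)^{k+l}` (root bound `|ρ| ≤ L (1 + |w|)`);
* `exists_mvPolynomial_fibreSum` — hence POLYNOMIALS in `w` of total degree `≤ k + l` (Liouville in `ℂ^m`,
  `exists_mvPolynomial_of_growth`).

Everything is proved; no definitions, no named facts.

## References

* J.-P. Serre, *Géométrie algébrique et géométrie analytique*, Ann. Inst. Fourier 6 (1956), n° 19 Lemme 8. [SerreGAGA1956]
* E. M. Chirka, *Complex Analytic Sets* (1989), §1.1 (p. 3–4: holomorphy of the root sums). [Chirka1989]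
-/

noncomputable section

open Polynomial Complex Metric Set Filter Finset
open scoped Topology

namespace Literature.Analysis.Complex

namespace AffineHypersurface

open SCV

variable {m d : ℕ} {c : ℂ} (P : Polynomial (MvPolynomial (Fin m) ℂ))

/-- **The fibre sums are entire functions of `w`.** [cite: SerreGAGA1956, n° 19 Lemme 8] -/
theorem differentiable_fibreSum (hc : c ≠ 0) (hPd : P.natDegree ≤ d) (hPlead : P.coeff d = MvPolynomial.C c)
    {L : ℝ} (hL : 1 ≤ L)
    (hroot : ∀ (w : Fin m → ℂ) (t : ℂ), (P.map (MvPolynomial.eval w)).IsRoot t → ‖t‖ ≤ L * (1 + ‖w‖))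
    {g : (Fin m → ℂ) × ℂ → ℂ}
    (hhol : ∀ x : (Fin m → ℂ) × ℂ, (P.map (MvPolynomial.eval x.1)).eval x.2 = 0 →
      ∃ W : Set ((Fin m → ℂ) × ℂ), IsOpen W ∧ x ∈ W ∧ ∃ G : (Fin m → ℂ) × ℂ → ℂ, DifferentiableOn ℂ G W ∧
        ∀ y ∈ W, (P.map (MvPolynomial.eval y.1)).eval y.2 = 0 → G y = g y)
    (l : ℕ) :
    Differentiable ℂ fun w : Fin m → ℂ ↦ (((P.map (MvPolynomial.eval w)).roots.map fun ρ ↦ ρ ^ l * g (w, ρ)).sum) := by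
  classical
  intro w₀
  set f : (Fin m → ℂ) × ℂ → ℂ := fun x ↦ (P.map (MvPolynomial.eval x.1)).eval x.2 with hf
  obtain ⟨ε, hε, -, δ, hδ, -, G, -, hV, hG, hGg, -, hsplit⟩ :=
    exists_cluster_package P hc hPd hPlead hL hroot hhol w₀
  set S₀ := (P.map (MvPolynomial.eval w₀)).roots.toFinset with hS₀
  -- the cluster-wise expression, holomorphic on the ball
  have hloc : DifferentiableOn ℂ
      (fun w ↦ ∑ τ ∈ S₀, ((sliceRoots f τ ε w).map fun ρ ↦ ρ ^ l * G τ (w, ρ)).sum) (ball w₀ δ) := by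
    refine DifferentiableOn.fun_sum fun τ hτ ↦ ?_
    exact (hV τ hτ).differentiableOn_rootSum (g := fun x ↦ x.2 ^ l * G τ x)
      ((differentiableOn_snd.pow l).mul (hG τ hτ))
  have heq : ∀ w ∈ ball w₀ δ, (((P.map (MvPolynomial.eval w)).roots.map fun ρ ↦ ρ ^ l * g (w, ρ)).sum) =
      ∑ τ ∈ S₀, ((sliceRoots f τ ε w).map fun ρ ↦ ρ ^ l * G τ (w, ρ)).sum := by
    intro w hw
    rw [hsplit w hw]
    have hms : ∀ (T : Finset ℂ) (N : ℂ → Multiset ℂ) (φ : ℂ → ℂ),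
        ((∑ τ ∈ T, N τ).map φ).sum = ∑ τ ∈ T, ((N τ).map φ).sum := by
      intro T N φ
      induction T using Finset.induction_on with
      | empty => simp
      | insert a T ha ih => rw [Finset.sum_insert ha, Finset.sum_insert ha, Multiset.map_add, Multiset.sum_add, ih]
    rw [hms]
    refine Finset.sum_congr rfl fun τ hτ ↦ ?_
    congr 1
    refine Multiset.map_congr rfl fun ρ hρ ↦ ?_
    have hρball : ρ ∈ ball τ ε := mem_ball_of_mem_rootMultiset hρ
    have hρ0 : f (w, ρ) = 0 :=
      ((mem_rootMultiset_iff ((hV τ hτ).differentiableOn_slice hw) (hV τ hτ).pos (hV τ hτ).lt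
        ((hV τ hτ).ne_zero w hw)).mp hρ).2
    rw [hGg τ hτ (w, ρ) (mk_mem_prod hw (ball_subset_ball (by linarith) hρball)) hρ0]
  have hdiff : DifferentiableOn ℂ
      (fun w : Fin m → ℂ ↦ (((P.map (MvPolynomial.eval w)).roots.map fun ρ ↦ ρ ^ l * g (w, ρ)).sum)) (ball w₀ δ) :=
    hloc.congr heq
  exact hdiff.differentiableAt (isOpen_ball.mem_nhds (mem_ball_self hδ))

/-- **Polynomial growth of the fibre sums**: `|b_l(w)| ≤ d C (1 + L)^k L^l (1 + |w|)^{k+l}` when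
`|g| ≤ C (1 + |(w, t)|)^k` on `U` and the roots are bounded by `L (1 + |w|)`. [cite: SerreGAGA1956, n° 19 Lemme 8] -/
theorem norm_fibreSum_le (hc : c ≠ 0) (hPd : P.natDegree ≤ d) (hPlead : P.coeff d = MvPolynomial.C c)
    {L : ℝ} (hL : 1 ≤ L)
    (hroot : ∀ (w : Fin m → ℂ) (t : ℂ), (P.map (MvPolynomial.eval w)).IsRoot t → ‖t‖ ≤ L * (1 + ‖w‖))
    {g : (Fin m → ℂ) × ℂ → ℂ} {C : ℝ} (hC : 0 ≤ C) {k : ℕ}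
    (hgr : ∀ x : (Fin m → ℂ) × ℂ, (P.map (MvPolynomial.eval x.1)).eval x.2 = 0 → ‖g x‖ ≤ C * (1 + ‖x‖) ^ k)
    (l : ℕ) (w : Fin m → ℂ) :
    ‖(((P.map (MvPolynomial.eval w)).roots.map fun ρ ↦ ρ ^ l * g (w, ρ)).sum)‖ ≤
      (d * (C * (1 + L) ^ k * L ^ l)) * (1 + ‖w‖) ^ (k + l) := by
  set M := (P.map (MvPolynomial.eval w)).roots with hM
  have hne0 := map_eval_ne_zero P hc hPlead w
  have hA : 0 ≤ 1 + ‖w‖ := by positivity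
  have hterm : ∀ ρ ∈ M, ‖ρ ^ l * g (w, ρ)‖ ≤ C * (1 + L) ^ k * L ^ l * (1 + ‖w‖) ^ (k + l) := by
    intro ρ hρ
    have hρ0 : (P.map (MvPolynomial.eval w)).eval ρ = 0 := (mem_roots hne0).mp hρ
    have hρL : ‖ρ‖ ≤ L * (1 + ‖w‖) := hroot w ρ hρ0
    have hx : ‖((w, ρ) : (Fin m → ℂ) × ℂ)‖ ≤ L * (1 + ‖w‖) := by
      rw [Prod.norm_def]
      refine max_le ?_ hρL
      nlinarith [norm_nonneg w]
    have h1 : ‖g (w, ρ)‖ ≤ C * ((1 + L) * (1 + ‖w‖)) ^ k := by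
      refine (hgr (w, ρ) hρ0).trans (mul_le_mul_of_nonneg_left (pow_le_pow_left₀ (by positivity) ?_ _) hC)
      nlinarith [norm_nonneg w]
    rw [norm_mul, norm_pow, pow_add]
    calc ‖ρ‖ ^ l * ‖g (w, ρ)‖ ≤ (L * (1 + ‖w‖)) ^ l * (C * ((1 + L) * (1 + ‖w‖)) ^ k) :=
          mul_le_mul (pow_le_pow_left₀ (norm_nonneg _) hρL _) h1 (norm_nonneg _) (by positivity)
      _ = C * (1 + L) ^ k * L ^ l * ((1 + ‖w‖) ^ k * (1 + ‖w‖) ^ l) := by rw [mul_pow, mul_pow]; ring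
  calc ‖(M.map fun ρ ↦ ρ ^ l * g (w, ρ)).sum‖
      ≤ (M.map fun ρ ↦ ‖ρ ^ l * g (w, ρ)‖).sum := by
        have := norm_multiset_sum_le (M.map fun ρ ↦ ρ ^ l * g (w, ρ))
        rwa [Multiset.map_map] at this
    _ ≤ Multiset.card (M.map fun ρ ↦ ‖ρ ^ l * g (w, ρ)‖) • (C * (1 + L) ^ k * L ^ l * (1 + ‖w‖) ^ (k + l)) := by
        refine Multiset.sum_le_card_nsmul _ _ fun x hx ↦ ?_
        obtain ⟨ρ, hρ, rfl⟩ := Multiset.mem_map.mp hx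
        exact hterm ρ hρ
    _ = (d * (C * (1 + L) ^ k * L ^ l)) * (1 + ‖w‖) ^ (k + l) := by
        rw [Multiset.card_map, hM, card_roots_map_eval P hc hPd hPlead, nsmul_eq_mul]; ring

/-- **The fibre sums are polynomials** of total degree `≤ k + l` (Serre's lemma: entire of polynomial growth, hence
polynomial by Liouville in `ℂ^m`). [cite: SerreGAGA1956, n° 19 Lemme 8] -/
theorem exists_mvPolynomial_fibreSum (hc : c ≠ 0) (hPd : P.natDegree ≤ d) (hPlead : P.coeff d = MvPolynomial.C c)
    {L : ℝ} (hL : 1 ≤ L)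
    (hroot : ∀ (w : Fin m → ℂ) (t : ℂ), (P.map (MvPolynomial.eval w)).IsRoot t → ‖t‖ ≤ L * (1 + ‖w‖))
    {g : (Fin m → ℂ) × ℂ → ℂ}
    (hhol : ∀ x : (Fin m → ℂ) × ℂ, (P.map (MvPolynomial.eval x.1)).eval x.2 = 0 →
      ∃ W : Set ((Fin m → ℂ) × ℂ), IsOpen W ∧ x ∈ W ∧ ∃ G : (Fin m → ℂ) × ℂ → ℂ, DifferentiableOn ℂ G W ∧
        ∀ y ∈ W, (P.map (MvPolynomial.eval y.1)).eval y.2 = 0 → G y = g y)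
    {C : ℝ} (hC : 0 ≤ C) {k : ℕ}
    (hgr : ∀ x : (Fin m → ℂ) × ℂ, (P.map (MvPolynomial.eval x.1)).eval x.2 = 0 → ‖g x‖ ≤ C * (1 + ‖x‖) ^ k)
    (l : ℕ) :
    ∃ b : MvPolynomial (Fin m) ℂ, b.totalDegree ≤ k + l ∧
      ∀ w, MvPolynomial.eval w b = (((P.map (MvPolynomial.eval w)).roots.map fun ρ ↦ ρ ^ l * g (w, ρ)).sum) :=
  exists_mvPolynomial_of_growth (differentiable_fibreSum P hc hPd hPlead hL hroot hhol l)
    (norm_fibreSum_le P hc hPd hPlead hL hroot hC hgr l)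

end AffineHypersurface

end Literature.Analysis.Complex
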